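import Literature.Barriers.CriticalPhenomena.GridSAWTowers
import Literature.Computability.Complexity.EncodingFrames
import HarnessLib

/-!
# Tower step of Theorem 7 (1) (Liśkiewicz–Ogihara–Toda 2003), machine part (T3): the realised
# subgraph `E₂` of the uniformised drawing as a FLAT indexed enumeration of unit edges

Sibling of `GridSAWTowers.lean` (the uniformised drawing `uniformize P D = (P₂, D₂)`: factor
`M = bigM Λ = 24Λ`, `Λ = maxEdges D`; every drawn path `π` replaced by `newPath Λ T π` =
`runWithTowers` on its first unit edge — `M` blocks `runBlock t`, block `t` carrying the tower of
height `6Λ` when `t ∈ towerOffsets Λ T` — followed by `scalePath` on the other unit edges) and of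
`GridSAWTowersReduction.lean` (the instance map `towerCode`, whose main case outputs the code of
`(E₂ - P₂[s], P₂[t] - P₂[s], 24Λ²(N-1))` with `E₂ = drawnEdges D₂`, and the named machine fact
`LOT2003_thm7_fixedLength_towers_FP : towerCode ∈ FP`). A polynomial-time GENERATOR of the code of
`E₂` is most simply an indexed fold (`Brick.foldLoop appF piece p` of `FoldBricks.lean`:
`acc := acc ++ piece ⟨x, 1ⁱ⟩` for `i < p(|x|)`) whose piece function computes the `i`-th unit edge
of `E₂` directly from the input and the index, by arithmetic. This file supplies the
machine-independent half of that generator — WHAT the `i`-th piece is — and proves that the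
pieces concatenate to the code of `E₂`:

* `edgesTo A n` (the `|A|` unit edges from the points of `A` to their successors, the last to
  `n`), `pathEdges_append_cons`, `edgesTo_append_cons`; `blockEdges M a u offs h t` — **the unit
  edges owned by block `t`** (from the run point `t`, through its tower if any, to the run point
  `t + 1`) — and `edgesTo_runFrom`: the edges of `runFrom` are the `flatMap` of its blocks;
* `segEdges`/`segBlock` (segment `q` of a path = its `q`-th unit edge enlarged, towers on
  segment `0` only) and **`pathEdges_newPath`**: the unit edges of `newPath Λ T π` are the
  `flatMap` over the segments `q < λ` of the `flatMap` over the blocks `t < M`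
  (`pathEdges_scalePath` for the plain part); `drawnEdges_uniformize` (over the drawn edges);
* framed codes `framesOf c E = frames (E.map c)` (the items part of an `Encoding.listBool` code,
  `EncodingFrames.lean`) for an arbitrary item coder `c`, and the `ccat` algebra of indexed
  pieces: `ccat_succ_left`, `ccat_add`, **`ccat_mul`/`ccat_radix`** (mixed radix),
  `ccat_eq_ccat_of_le`, `framesOf_flatMap_range`, `ccat_getElem?_eq_framesOf` (a short list
  position by position), `framesOf_flatMap`;
* **`pieceAt Λ D c e q t m`** — the frame of the `m`-th unit edge of block `t` of segment `q` of
  `D[e]`, empty out of range — its flat form `pieceFlat Λ D c i` (position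
  `i < totalPieces Λ D = |D| · Λ · 24Λ · (12Λ + 2)` in mixed radix `(e, q, t, m)`; a block has at
  most `12Λ + 1 < radixB Λ = 12Λ + 2` edges, `length_segBlock_le`), and the main theorem
  **`framesOf_drawnEdges_uniformize`**:
  `framesOf c (drawnEdges (uniformize P D).2) = ccat (pieceFlat (maxEdges D) D c) (totalPieces …)`
  whenever every drawn path has at least two points (true for a valid drawing);
* the pieces IN CLOSED FORM, as the generator computes them: `towerBlockPt M a u t h j` (the
  `j`-th point of a block: `towerPt t j` up the first column for `j ≤ h`, `towerPt (t+1) (2h+1-j)`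
  down the second; `h = 0` for a plain block), `runPt_cons_tower_eq`, and
  **`getElem?_blockEdges`**: the `m`-th edge of block `t` is
  `(towerBlockPt t h' m, towerBlockPt t h' (m+1))` for `m ≤ 2h'` (`h' = h` under a tower, else
  `0`) and none after; `mem_towerOffsets_iff` (`t ∈ towerOffsets Λ T ↔ 8Λ ≤ t < 8Λ + 2T ∧
  2 ∣ t - 8Λ`).

So the piece of position `(e, q, t, m)` is decided by: `q + 1 < |π_e|`; `h' = 6Λ` if `q = 0`
and `8Λ ≤ t < 8Λ + 4(Λ - λ_e)` with `t - 8Λ` even, else `0`; `m ≤ 2h'`; and then two evaluations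
of `towerPt M a u c k = M a + c u + k rot u` at `a = π_e[q]`, `u = π_e[q+1] - π_e[q]` — integer
arithmetic available in the brick toolkit (`ZIntBricks.lean`). The brick assembly of the piece
function, the fold, and the remaining fields `P₂[t] - P₂[s]`, `24Λ²(N-1)` are the next files of
(T3) by the author of this one (tenure on `LOT2003_thm7_fixedLength_towers`); the input side
(canonical re-encoding of presentation codes, the validity test `IsGridDrawing`) is being supplied
in parallel (`CanonicalCodes.canonListFnC`, `GridSAWInstanceCanon.lean`).

## References

* M. Liśkiewicz, M. Ogihara, S. Toda, *The complexity of counting self-avoiding walks in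
  subgraphs of two-dimensional grids and hypercubes*, TCS 304 (2003) 129–156, §4, proof of
  Theorem 7 (`E₂`: "We replace for each `i` … the edge `a(2i)` by the tower"; `R₁(x) = (E₂, τ, h)`).
* S. Arora, B. Barak, *Computational Complexity: A Modern Approach*, CUP 2009, §0.1 (codes of
  lists), §1.3 (polynomial time: composition and bounded loops).
-/

namespace Literature.Barriers.CriticalPhenomena.GridSAW

open Literature.Computability.Complexity Literature.Computability.Complexity.Com

/-! ### Edges from a point list to a next point -/

/-- The unit edges from each point of `A` to its successor, the last point being joined to `n`
(so `A` "owns" `|A|` edges). [folklore] -/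
def edgesTo (A : List GridPoint) (n : GridPoint) : EdgeList := pathEdges (A ++ [n])

/-- No points, no edges. [folklore] -/
@[simp] theorem edgesTo_nil (n : GridPoint) : edgesTo [] n = [] := rfl

/-- One point, one edge. [folklore] -/
@[simp] theorem edgesTo_singleton (a n : GridPoint) : edgesTo [a] n = [(a, n)] := rfl

/-- Peeling the first edge. [folklore] -/
@[simp] theorem edgesTo_cons_cons (a b : GridPoint) (A : List GridPoint) (n : GridPoint) :
    edgesTo (a :: b :: A) n = (a, b) :: edgesTo (b :: A) n := rfl

/-- The edges of a concatenation: the first part owns its edges up to the head of the second.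
[folklore] -/
theorem pathEdges_append_cons : ∀ (A : List GridPoint) (b : GridPoint) (B : List GridPoint),
    pathEdges (A ++ b :: B) = edgesTo A b ++ pathEdges (b :: B)
  | [], _, _ => rfl
  | [_], _, _ => rfl
  | a :: a' :: A, b, B => by
    rw [List.cons_append, List.cons_append, pathEdges_cons_cons, ← List.cons_append,
      pathEdges_append_cons (a' :: A) b B]
    rfl

/-- `edgesTo` of a concatenation. [folklore] -/
theorem edgesTo_append_cons (A : List GridPoint) (b : GridPoint) (B : List GridPoint) (n : GridPoint) :
    edgesTo (A ++ b :: B) n = edgesTo A b ++ edgesTo (b :: B) n := by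
  unfold edgesTo
  rw [List.append_assoc, List.cons_append, pathEdges_append_cons]
  rfl

/-- `edgesTo` has one edge per point. [folklore] -/
@[simp] theorem length_edgesTo : ∀ (A : List GridPoint) (n : GridPoint), (edgesTo A n).length = A.length
  | [], _ => rfl
  | [_], _ => rfl
  | a :: b :: A, n => by rw [edgesTo_cons_cons, List.length_cons, length_edgesTo (b :: A) n]; rfl

/-! ### The unit edges owned by one block of a run -/

/-- **The unit edges of block `t`** of the run of `(a, a + u)` with tower offsets `offs` and
height `h`: from the run point `t` (through the tower over the unit edge `t`, if `t ∈ offs`) to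
the run point `t + 1`. [cite: LiskiewiczOgiharaToda2003, §4 (proof of Theorem 7, E₂: runs and towers)] -/
def blockEdges (M : ℕ) (a u : GridPoint) (offs : List ℕ) (h t : ℕ) : EdgeList :=
  edgesTo (runBlock M a u offs h t) (runPt M a u (t + 1))

/-- A block without tower owns the single run edge. [folklore] -/
theorem blockEdges_of_not_mem {M : ℕ} {a u : GridPoint} {offs : List ℕ} {h t : ℕ} (ht : t ∉ offs) :
    blockEdges M a u offs h t = [(runPt M a u t, runPt M a u (t + 1))] := by
  simp [blockEdges, runBlock, ht]

/-- A block with tower owns the run point and the tower, up to the next run point. [folklore] -/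
theorem blockEdges_of_mem {M : ℕ} {a u : GridPoint} {offs : List ℕ} {h t : ℕ} (ht : t ∈ offs) :
    blockEdges M a u offs h t = edgesTo (runPt M a u t :: tower M a u t h) (runPt M a u (t + 1)) := by
  simp [blockEdges, runBlock, ht]

/-- The number of edges of a block: `1`, plus `2h` under a tower. [folklore] -/
theorem length_blockEdges (M : ℕ) (a u : GridPoint) (offs : List ℕ) (h t : ℕ) :
    (blockEdges M a u offs h t).length = if t ∈ offs then 2 * h + 1 else 1 := by
  rw [blockEdges, length_edgesTo, runBlock]
  split_ifs <;> simp

/-- The blocks from `t` on, `n + 1` of them, start with the run point `t`. [folklore] -/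
theorem runFrom_succ (M : ℕ) (a u : GridPoint) (offs : List ℕ) (h t n : ℕ) :
    runFrom M a u offs h t (n + 1) =
      runPt M a u t :: ((if t ∈ offs then tower M a u t h else []) ++ runFrom M a u offs h (t + 1) n) := by
  simp [runFrom, runBlock]

/-- **The edges of the blocks from `t` on are the edges of the blocks.** [folklore] -/
theorem edgesTo_runFrom (M : ℕ) (a u : GridPoint) (offs : List ℕ) (h : ℕ) :
    ∀ (n t : ℕ), edgesTo (runFrom M a u offs h t n) (runPt M a u (t + n)) =
      (List.range n).flatMap fun j => blockEdges M a u offs h (t + j)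
  | 0, t => by simp [runFrom]
  | 1, t => by simp [runFrom, blockEdges]
  | n + 2, t => by
    rw [List.range_succ_eq_map, List.flatMap_cons, List.flatMap_map, Nat.add_zero, runFrom,
      runFrom_succ M a u offs h (t + 1) n, edgesTo_append_cons, ← runFrom_succ,
      show t + (n + 1 + 1) = (t + 1) + (n + 1) by omega, edgesTo_runFrom M a u offs h (n + 1) (t + 1)]
    simp only [blockEdges, show ∀ j, t + 1 + j = t + (j + 1) by omega, Nat.add_zero,
      Nat.succ_eq_add_one]

/-! ### The unit edges of a new path, segment by segment -/

/-- **The unit edges of segment `q`** (the `q`-th unit edge of the path `π`, enlarged; with the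
towers when `q = 0`): `M` blocks. Junk (never used) when `q + 1 ≥ |π|`.
[cite: LiskiewiczOgiharaToda2003, §4 (proof of Theorem 7, E₂)] -/
def segEdges (Λ T : ℕ) (π : List GridPoint) (q : ℕ) : EdgeList :=
  (List.range (bigM Λ)).flatMap fun t =>
    blockEdges (bigM Λ) (π.getD q 0) (π.getD (q + 1) 0 - π.getD q 0)
      (if q = 0 then towerOffsets Λ T else []) (if q = 0 then 6 * Λ else 1) t

/-- A scaled path starts with the scaled first point. [folklore] -/
theorem scalePath_cons_eq {M : ℕ} (hM : 1 ≤ M) (p : GridPoint) (l : List GridPoint) :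
    scalePath M (p :: l) = ((M : ℤ) • p) :: (scalePath M (p :: l)).tail :=
  (List.cons_head?_tail (head?_scalePath hM p l)).symm

/-- The plain segments of a scaled path. [folklore] -/
theorem pathEdges_scalePath {M : ℕ} (hM : 1 ≤ M) :
    ∀ (p : GridPoint) (l : List GridPoint), pathEdges (scalePath M (p :: l)) =
      (List.range l.length).flatMap fun j =>
        (List.range M).flatMap fun t =>
          blockEdges M ((p :: l).getD j 0) ((p :: l).getD (j + 1) 0 - (p :: l).getD j 0) [] 1 t
  | p, [] => rfl
  | p, q :: l => by
    rw [scalePath, scalePath_cons_eq hM q l, pathEdges_append_cons, ← scalePath_cons_eq hM q l,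
      pathEdges_scalePath hM q l, List.length_cons, List.range_succ_eq_map, List.flatMap_cons,
      List.flatMap_map]
    congr 1
    have h := edgesTo_runFrom M p (q - p) [] 1 M 0
    simp only [Nat.zero_add, runPt_self, add_sub_cancel] at h
    rw [h]
    rfl

/-- **The unit edges of the new path are those of its segments** `q < λ` (number of unit edges of
`π`). [cite: LiskiewiczOgiharaToda2003, §4 (proof of Theorem 7, E₂)] -/
theorem pathEdges_newPath {Λ : ℕ} (hΛ : 1 ≤ Λ) (T : ℕ) (p q : GridPoint) (l : List GridPoint) :
    pathEdges (newPath Λ T (p :: q :: l)) =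
      (List.range (l.length + 1)).flatMap (segEdges Λ T (p :: q :: l)) := by
  have hM : 1 ≤ bigM Λ := by unfold bigM; omega
  rw [newPath, scalePath_cons_eq hM q l, pathEdges_append_cons, ← scalePath_cons_eq hM q l,
    pathEdges_scalePath hM q l, List.range_succ_eq_map, List.flatMap_cons, List.flatMap_map]
  congr 1
  have h := edgesTo_runFrom (bigM Λ) p (q - p) (towerOffsets Λ T) (6 * Λ) (bigM Λ) 0
  simp only [Nat.zero_add, runPt_self, add_sub_cancel] at h
  rw [runWithTowers, h]
  rfl


/-! ### Framed codes of edge lists and concatenations of indexed pieces -/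

section Frames

variable (c : GridPoint × GridPoint → List Bool)

/-- The framed code of an edge list under the item coder `c` (`frames` of `EncodingFrames.lean`:
each item doubled and closed by `01`, as in `Encoding.listBool`). [cite: AroraBarak2009, §0.1 (coding of lists)] -/
def framesOf (E : EdgeList) : List Bool := frames (E.map c)

/-- `framesOf` is a monoid morphism. [folklore] -/
theorem framesOf_append (E E' : EdgeList) : framesOf c (E ++ E') = framesOf c E ++ framesOf c E' := by
  simp [framesOf, frames_append]

/-- `framesOf` of no edge. [folklore] -/
@[simp] theorem framesOf_nil : framesOf c [] = [] := rfl

/-- `framesOf` of one edge: its frame. [folklore] -/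
theorem framesOf_singleton (XY : GridPoint × GridPoint) :
    framesOf c [XY] = repBits 2 (c XY) ++ [false, true] := by
  simp [framesOf]

/-- Peeling the first piece of a concatenation. [folklore] -/
theorem ccat_succ_left (g : ℕ → List Bool) : ∀ n : ℕ, ccat g (n + 1) = g 0 ++ ccat (fun i => g (i + 1)) n
  | 0 => by simp [ccat]
  | n + 1 => by rw [ccat_succ, ccat_succ_left g n, List.append_assoc, ← ccat_succ]

/-- Splitting a concatenation. [folklore] -/
theorem ccat_add (g : ℕ → List Bool) (n : ℕ) : ∀ k : ℕ, ccat g (n + k) = ccat g n ++ ccat (fun i => g (n + i)) k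
  | 0 => by simp
  | k + 1 => by rw [← Nat.add_assoc, ccat_succ, ccat_add g n k, ccat_succ, List.append_assoc]

/-- **Mixed radix**: a concatenation over `n K` indices is a concatenation over `n` blocks of `K`.
[folklore] -/
theorem ccat_mul (g : ℕ → List Bool) (K : ℕ) : ∀ n : ℕ,
    ccat g (n * K) = ccat (fun a => ccat (fun b => g (a * K + b)) K) n
  | 0 => by simp
  | n + 1 => by rw [Nat.succ_mul, ccat_add, ccat_mul g K n, ccat_succ]

/-- A concatenation whose pieces vanish from `k` on. [folklore] -/
theorem ccat_eq_ccat_of_le {g : ℕ → List Bool} {k n : ℕ} (hkn : k ≤ n) (h : ∀ i, k ≤ i → g i = []) :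
    ccat g n = ccat g k := by
  obtain ⟨d, rfl⟩ := Nat.exists_eq_add_of_le hkn
  rw [ccat_add]
  suffices hz : ccat (fun i => g (k + i)) d = [] by rw [hz, List.append_nil]
  induction d with
  | zero => rfl
  | succ d ih => rw [ccat_succ, ih (by omega), h _ (by omega), List.append_nil]

/-- **The framed code of a `flatMap` over a range is a concatenation of framed codes.** [folklore] -/
theorem framesOf_flatMap_range (g : ℕ → EdgeList) :
    ∀ n : ℕ, framesOf c ((List.range n).flatMap g) = ccat (fun j => framesOf c (g j)) n
  | 0 => rfl
  | n + 1 => by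
    rw [List.range_succ, List.flatMap_append, framesOf_append, framesOf_flatMap_range g n, ccat_succ]
    simp

/-- **The framed code of a short list, position by position**: with `|L| ≤ B`, the concatenation
over `m < B` of the frame of `L[m]` (nothing past the end) is `framesOf c L`. [folklore] -/
theorem ccat_getElem?_eq_framesOf : ∀ (L : EdgeList) (B : ℕ), L.length ≤ B →
    ccat (fun m => match L[m]? with
      | some XY => repBits 2 (c XY) ++ [false, true]
      | none => []) B = framesOf c L
  | [], B, _ => by
    rw [ccat_eq_ccat_of_le (Nat.zero_le B) (fun i _ => by simp)]
    rfl
  | XY :: L, 0, h => by simp at h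
  | XY :: L, B + 1, h => by
    rw [ccat_succ_left, show framesOf c (XY :: L) = framesOf c [XY] ++ framesOf c L from
      framesOf_append c [XY] L, framesOf_singleton, ← ccat_getElem?_eq_framesOf L B (by simpa using h)]
    simp

/-- The framed code of a `flatMap` over a list, through positions. [folklore] -/
theorem framesOf_flatMap (g : DrawnEdge → EdgeList) : ∀ D : List DrawnEdge,
    framesOf c (D.flatMap g) = ccat (fun e => match D[e]? with
      | some d => framesOf c (g d)
      | none => []) D.length
  | [] => rfl
  | d :: D => by
    rw [List.flatMap_cons, framesOf_append, List.length_cons, ccat_succ_left, framesOf_flatMap g D]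
    simp

end Frames

/-! ### The flat enumeration of the unit edges of `E₂` -/

/-- The block `t` of segment `q` of a path `π` with `T` towers (towers only on segment `0`).
[cite: LiskiewiczOgiharaToda2003, §4 (proof of Theorem 7, E₂)] -/
def segBlock (Λ T : ℕ) (π : List GridPoint) (q t : ℕ) : EdgeList :=
  blockEdges (bigM Λ) (π.getD q 0) (π.getD (q + 1) 0 - π.getD q 0)
    (if q = 0 then towerOffsets Λ T else []) (if q = 0 then 6 * Λ else 1) t

/-- `segEdges` is the `flatMap` of its blocks. [folklore] -/
theorem segEdges_eq (Λ T : ℕ) (π : List GridPoint) (q : ℕ) :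
    segEdges Λ T π q = (List.range (bigM Λ)).flatMap (segBlock Λ T π q) := rfl

/-- The width of the innermost radix: `12Λ + 2 > 2h + 1`, the number of edges of a block under
a tower of height `h = 6Λ`. [folklore] -/
def radixB (Λ : ℕ) : ℕ := 12 * Λ + 2

/-- **The piece at position `(e, q, t, m)`**: the frame of the `m`-th unit edge of block `t` of
segment `q` of the drawn edge `D[e]` in the uniformised drawing (`Λ = maxEdges D`), under the
item coder `c`; empty when `e`, `q` or `m` is out of range. [cite: LiskiewiczOgiharaToda2003, §4 (proof of Theorem 7, E₂)] -/
def pieceAt (Λ : ℕ) (D : List DrawnEdge) (c : GridPoint × GridPoint → List Bool) (e q t m : ℕ) :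
    List Bool :=
  match D[e]? with
  | none => []
  | some d =>
    if q + 1 < d.2.2.length then
      match (segBlock Λ (towerCount Λ d) d.2.2 q t)[m]? with
      | some XY => repBits 2 (c XY) ++ [false, true]
      | none => []
    else []

/-- **The flat piece function**: position `i < |D| · Λ · M · (12Λ + 2)` read in mixed radix
`(e, q, t, m)`. [cite: LiskiewiczOgiharaToda2003, §4 (proof of Theorem 7, E₂)] -/
def pieceFlat (Λ : ℕ) (D : List DrawnEdge) (c : GridPoint × GridPoint → List Bool) (i : ℕ) : List Bool :=
  pieceAt Λ D c (i / (Λ * (bigM Λ * radixB Λ))) (i % (Λ * (bigM Λ * radixB Λ)) / (bigM Λ * radixB Λ))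
    (i % (Λ * (bigM Λ * radixB Λ)) % (bigM Λ * radixB Λ) / radixB Λ)
    (i % (Λ * (bigM Λ * radixB Λ)) % (bigM Λ * radixB Λ) % radixB Λ)

/-- The total number of positions. [folklore] -/
def totalPieces (Λ : ℕ) (D : List DrawnEdge) : ℕ := D.length * (Λ * (bigM Λ * radixB Λ))

/-- A block has at most `12Λ + 1 < radixB Λ` edges. [folklore] -/
theorem length_segBlock_le (Λ T : ℕ) (π : List GridPoint) (q t : ℕ) :
    (segBlock Λ T π q t).length ≤ radixB Λ := by
  rw [segBlock, length_blockEdges, radixB]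
  by_cases hq : q = 0
  · simp only [hq, ↓reduceIte]
    split_ifs <;> omega
  · simp [hq]

/-- The realised subgraph of the uniformised drawing, edge by edge. [folklore] -/
theorem drawnEdges_uniformize (P : List GridPoint) (D : List DrawnEdge) :
    drawnEdges (uniformize P D).2 =
      D.flatMap fun d => pathEdges (newPath (maxEdges D) (towerCount (maxEdges D) d) d.2.2) := by
  simp [drawnEdges, uniformize, List.flatMap_map]

/-- The framed code of the new path of one drawn edge, as the concatenation over `(q, t, m)`.
[folklore] -/
theorem framesOf_pathEdges_newPath {Λ : ℕ} (hΛ : 1 ≤ Λ) (c : GridPoint × GridPoint → List Bool)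
    (d : DrawnEdge) (h2 : 2 ≤ d.2.2.length) (hle : d.2.2.length - 1 ≤ Λ) :
    framesOf c (pathEdges (newPath Λ (towerCount Λ d) d.2.2)) =
      ccat (fun q => ccat (fun t => ccat (fun m =>
        if q + 1 < d.2.2.length then
          match (segBlock Λ (towerCount Λ d) d.2.2 q t)[m]? with
          | some XY => repBits 2 (c XY) ++ [false, true]
          | none => []
        else []) (radixB Λ)) (bigM Λ)) Λ := by
  obtain ⟨p, q, l, hπ⟩ : ∃ p q l, d.2.2 = p :: q :: l := by
    match h : d.2.2, h2 with
    | p :: q :: l, _ => exact ⟨p, q, l, rfl⟩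
  rw [hπ, pathEdges_newPath hΛ, framesOf_flatMap_range]
  rw [hπ] at hle
  simp only [List.length_cons, Nat.add_sub_cancel] at hle
  rw [ccat_eq_ccat_of_le (g := fun q => ccat _ (bigM Λ)) hle (fun i hi => ?_)]
  · refine ccat_congr fun i hi => ?_
    rw [segEdges_eq, framesOf_flatMap_range]
    refine ccat_congr fun t _ => ?_
    rw [ccat_congr (g' := fun m => match (segBlock Λ (towerCount Λ d) (p :: q :: l) i t)[m]? with
      | some XY => repBits 2 (c XY) ++ [false, true] | none => []) (fun m _ => by
        rw [if_pos (by simp; omega)]), ccat_getElem?_eq_framesOf c _ _ (length_segBlock_le _ _ _ _ _)]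
  · -- past the last segment every piece is empty
    rw [ccat_congr (g' := fun _ => []) (fun t _ => ccat_congr (g' := fun _ => []) (fun m _ => by
      rw [if_neg (by simp; omega)]) |>.trans ?_)]
    · exact ccat_nil_pieces _
    · exact ccat_nil_pieces _
where
  /-- A concatenation of empty pieces is empty. [folklore] -/
  ccat_nil_pieces : ∀ n : ℕ, ccat (fun _ => ([] : List Bool)) n = []
  | 0 => rfl
  | n + 1 => by rw [ccat_succ, ccat_nil_pieces n]; rfl


/-- **Mixed radix for a two-argument piece function.** [folklore] -/
theorem ccat_radix (G : ℕ → ℕ → List Bool) {K : ℕ} (hK : 0 < K) (n : ℕ) :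
    ccat (fun i => G (i / K) (i % K)) (n * K) = ccat (fun a => ccat (fun b => G a b) K) n := by
  rw [ccat_mul]
  refine ccat_congr fun a _ => ccat_congr fun b hb => ?_
  rw [Nat.add_comm, Nat.add_mul_div_right _ _ hK, Nat.div_eq_of_lt hb, Nat.zero_add,
    Nat.add_mul_mod_self_right, Nat.mod_eq_of_lt hb]

/-- `Λ = maxEdges D ≥ 1`, so all radices are positive. [folklore] -/
theorem radix_pos {Λ : ℕ} (hΛ : 1 ≤ Λ) :
    0 < radixB Λ ∧ 0 < bigM Λ * radixB Λ ∧ 0 < Λ * (bigM Λ * radixB Λ) := by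
  have h1 : 0 < radixB Λ := by unfold radixB; omega
  have h2 : 0 < bigM Λ := by unfold bigM; omega
  exact ⟨h1, Nat.mul_pos h2 h1, Nat.mul_pos (by omega) (Nat.mul_pos h2 h1)⟩

/-- **The flat enumeration of `E₂`.** For a list of drawn edges whose paths have at least two
points each, the framed code (item coder `c`) of the realised subgraph of the uniformised drawing
is the concatenation of the flat pieces over all `|D| · Λ · 24Λ · (12Λ + 2)` positions: every
unit edge of `E₂ = drawnEdges (uniformize P D).2` is produced exactly once, in order, from its
mixed-radix position `(e, q, t, m)` — drawn edge, segment, block, edge within the block — and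
all other positions produce nothing. [cite: LiskiewiczOgiharaToda2003, §4 (proof of Theorem 7: E₂ = the towers construction applied to every edge of G′)] -/
theorem framesOf_drawnEdges_uniformize (P : List GridPoint) {D : List DrawnEdge}
    (hD : ∀ d ∈ D, 2 ≤ d.2.2.length) (c : GridPoint × GridPoint → List Bool) :
    framesOf c (drawnEdges (uniformize P D).2) =
      ccat (pieceFlat (maxEdges D) D c) (totalPieces (maxEdges D) D) := by
  have hΛ : 1 ≤ maxEdges D := one_le_maxEdges D
  obtain ⟨hB, hK₂, hK₁⟩ := radix_pos hΛ
  rw [drawnEdges_uniformize, framesOf_flatMap, totalPieces]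
  -- peel the drawn-edge index
  refine Eq.trans ?_ (ccat_radix (K := maxEdges D * (bigM (maxEdges D) * radixB (maxEdges D)))
    (fun e j => pieceAt (maxEdges D) D c e (j / (bigM (maxEdges D) * radixB (maxEdges D)))
      (j % (bigM (maxEdges D) * radixB (maxEdges D)) / radixB (maxEdges D))
      (j % (bigM (maxEdges D) * radixB (maxEdges D)) % radixB (maxEdges D))) hK₁ D.length).symm
  refine ccat_congr fun e he => ?_
  rw [List.getElem?_eq_getElem he]
  dsimp only
  -- peel the segment index, then the block index
  refine Eq.trans ?_ (ccat_radix (K := bigM (maxEdges D) * radixB (maxEdges D))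
    (fun q j₂ => pieceAt (maxEdges D) D c e q (j₂ / radixB (maxEdges D)) (j₂ % radixB (maxEdges D)))
    hK₂ (maxEdges D)).symm
  refine Eq.trans ?_ (ccat_congr fun q _ => (ccat_radix (K := radixB (maxEdges D))
    (fun t m => pieceAt (maxEdges D) D c e q t m) hB (bigM (maxEdges D))).symm)
  -- the pieces of one drawn edge
  rw [framesOf_pathEdges_newPath hΛ c _ (hD _ (List.getElem_mem he))
    (length_sub_one_le_maxEdges (List.getElem_mem he))]
  refine ccat_congr fun q _ => ccat_congr fun t _ => ccat_congr fun m _ => ?_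
  simp only [pieceAt, List.getElem?_eq_getElem he]


/-! ### The unit edges of a block in closed form, by position -/

/-- `towerPt` at height `0` is the run point. [folklore] -/
theorem towerPt_zero_height (M : ℕ) (a u : GridPoint) (c : ℕ) : towerPt M a u c 0 = runPt M a u c := by
  simp [towerPt, runPt]

/-- **The `j`-th point of a block with a tower of height `h`** (run point, up the column `t`,
down the column `t + 1`, next run point): `towerPt t j` for `j ≤ h`, `towerPt (t+1) (2h+1-j)`
after. With `h = 0` this lists the run point and the next run point. [cite: LiskiewiczOgiharaToda2003, §4 (proof of Theorem 7, Fig. 7: the tower)] -/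
def towerBlockPt (M : ℕ) (a u : GridPoint) (t h j : ℕ) : GridPoint :=
  if j ≤ h then towerPt M a u t j else towerPt M a u (t + 1) (2 * h + 1 - j)

/-- The edges of a `map` over a range are the consecutive pairs. [folklore] -/
theorem pathEdges_map_range : ∀ (n : ℕ) (f : ℕ → GridPoint),
    pathEdges ((List.range (n + 1)).map f) = (List.range n).map fun j => (f j, f (j + 1))
  | 0, _ => rfl
  | n + 1, f => by
    have ih := pathEdges_map_range n (fun j => f (j + 1))
    rw [List.range_succ_eq_map, List.map_cons, List.map_map] at ih ⊢
    rw [List.range_succ_eq_map, List.map_cons, List.map_map, pathEdges_cons_cons]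
    simp only [Function.comp_def, Nat.zero_add] at ih ⊢
    rw [ih]
    simp

/-- **The block with a tower, listed point by point**: the run point, the tower, and the next run
point are the `2h + 2` points `towerBlockPt t h j`. [folklore] -/
theorem runPt_cons_tower_eq (M : ℕ) (a u : GridPoint) (t h : ℕ) :
    runPt M a u t :: tower M a u t h ++ [runPt M a u (t + 1)] =
      (List.range (2 * h + 2)).map (towerBlockPt M a u t h) := by
  refine List.ext_getElem (by simp) fun j h₁ h₂ => ?_
  rw [List.getElem_map, List.getElem_range, towerBlockPt]
  rcases j with _ | j
  · simp [towerPt_zero_height]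
  · by_cases hjt : j < 2 * h
    · rw [List.getElem_append_left (by simp; omega), List.getElem_cons_succ]
      unfold tower
      by_cases hup : j < h
      · rw [List.getElem_append_left (by simpa using hup), List.getElem_map, List.getElem_range,
          if_pos (by omega)]
      · rw [List.getElem_append_right (by simpa using hup), List.getElem_map, List.getElem_reverse,
          List.getElem_range, if_neg (by omega)]
        simp only [List.length_map, List.length_range]
        congr 1
        omega
    · rw [List.getElem_append_right (by simp; omega)]
      simp only [List.length_cons, length_tower, List.getElem_singleton]
      rw [if_neg (by omega), show 2 * h + 1 - (j + 1) = 0 by omega, towerPt_zero_height]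

/-- **The unit edges of a block by position**: with `h' = h` under a tower and `h' = 0`
otherwise, the `m`-th edge is `(towerBlockPt t h' m, towerBlockPt t h' (m + 1))` for `m ≤ 2h'`,
and there is no other. [folklore] -/
theorem getElem?_blockEdges (M : ℕ) (a u : GridPoint) (offs : List ℕ) (h t m : ℕ) :
    (blockEdges M a u offs h t)[m]? =
      if m ≤ 2 * (if t ∈ offs then h else 0) then
        some (towerBlockPt M a u t (if t ∈ offs then h else 0) m,
          towerBlockPt M a u t (if t ∈ offs then h else 0) (m + 1))
      else none := by
  have key : ∀ h' : ℕ, (edgesTo (runPt M a u t :: tower M a u t h') (runPt M a u (t + 1)))[m]? =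
      if m ≤ 2 * h' then some (towerBlockPt M a u t h' m, towerBlockPt M a u t h' (m + 1)) else none := by
    intro h'
    rw [edgesTo, List.cons_append, ← List.cons_append, runPt_cons_tower_eq,
      show 2 * h' + 2 = (2 * h' + 1) + 1 by ring, pathEdges_map_range, List.getElem?_map]
    by_cases hm : m ≤ 2 * h'
    · rw [List.getElem?_range (by omega), if_pos hm]; rfl
    · rw [List.getElem?_eq_none (by simp; omega), if_neg hm]; rfl
  by_cases ht : t ∈ offs
  · rw [blockEdges_of_mem ht, key, if_pos ht]
  · have h0 : blockEdges M a u offs h t = edgesTo (runPt M a u t :: tower M a u t 0) (runPt M a u (t + 1)) := by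
      rw [blockEdges_of_not_mem ht]; simp [tower, edgesTo]
    rw [h0, key, if_neg ht]

/-- Membership in the tower offsets, arithmetically: `8Λ ≤ o < 8Λ + 2T` and `o - 8Λ` even.
[folklore] -/
theorem mem_towerOffsets_iff (Λ T o : ℕ) :
    o ∈ towerOffsets Λ T ↔ 8 * Λ ≤ o ∧ o < 8 * Λ + 2 * T ∧ (o - 8 * Λ) % 2 = 0 := by
  rw [mem_towerOffsets]
  constructor
  · rintro ⟨j, hj, rfl⟩; omega
  · rintro ⟨h1, h2, h3⟩; exact ⟨(o - 8 * Λ) / 2, by omega, by omega⟩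


/-! ### Sanity checks -/

/-- A block under a tower of height `6` (offset `8 ∈ towerOffsets 1 2 = [8, 10]`) owns `13` unit
edges; a plain block owns one. [folklore] -/
theorem length_blockEdges_examples :
    (blockEdges 24 (0, 0) (1, 0) (towerOffsets 1 2) 6 8).length = 13 ∧
      (blockEdges 24 (0, 0) (1, 0) (towerOffsets 1 2) 6 9).length = 1 := by
  rw [length_blockEdges, length_blockEdges]
  decide

/-- On the one-edge drawing of the pivot file (`Λ = 1`, one drawn edge) there are
`1 · 1 · 24 · 14 = 336` positions. [folklore] -/
theorem totalPieces_oneEdge : totalPieces (maxEdges oneEdgeDrawing.2) oneEdgeDrawing.2 = 336 := by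
  rw [maxEdges_oneEdge]; rfl

/-- Non-vacuity of the flat enumeration: the code of the realised subgraph of the uniformised
one-edge drawing (a straight path of `24` unit edges) is the concatenation of its `336` flat
pieces (`312` of which are empty). [folklore] -/
theorem framesOf_uniformize_oneEdge (c : GridPoint × GridPoint → List Bool) :
    framesOf c (drawnEdges (uniformize oneEdgeDrawing.1 oneEdgeDrawing.2).2) =
      ccat (pieceFlat 1 oneEdgeDrawing.2 c) 336 := by
  have h := framesOf_drawnEdges_uniformize oneEdgeDrawing.1 (D := oneEdgeDrawing.2) (by decide) c
  rwa [totalPieces_oneEdge, maxEdges_oneEdge] at h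

/-- … and that subgraph has exactly `24` unit edges (so the concatenation has `24` frames).
[folklore] -/
theorem length_drawnEdges_uniformize_oneEdge :
    (drawnEdges (uniformize oneEdgeDrawing.1 oneEdgeDrawing.2).2).length = 24 := by
  rw [drawnEdges_uniformize, maxEdges_oneEdge]
  show (pathEdges (newPath 1 (towerCount 1 (0, 1, [((0 : ℤ), (0 : ℤ)), (0, 1)])) [((0 : ℤ), (0 : ℤ)), (0, 1)]) ++ []).length = 24
  rw [List.append_nil, pathEdges_newPath le_rfl]
  simp only [List.length_nil, Nat.zero_add, List.range_one, List.flatMap_cons, List.flatMap_nil,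
    List.append_nil, segEdges_eq, List.length_flatMap]
  have h0 : towerCount 1 (0, 1, [((0 : ℤ), (0 : ℤ)), (0, 1)]) = 0 := by decide
  have hoff : towerOffsets 1 0 = [] := rfl
  simp only [h0, hoff, segBlock, ↓reduceIte, length_blockEdges, List.not_mem_nil, bigM]
  decide

end Literature.Barriers.CriticalPhenomena.GridSAW
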